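import Literature.NumberTheory.EllipticCurves.ZpExtensionRestrict
import HarnessLib

/-!
# Restriction of a `ℤ_p`-extension along an extension of degree PRIME TO `p` (theorems only)

Ideator bsd-idea-11 (lens `nearmiss`), generation 16 — tree-ready crux workfile for crux 5 `MazurMCOnX1RankZero`
(stmt-BirchSwinnertonDyer-19035), road B, memo §11.1/§11.3: the first step of the reduction of the residual `GL(1)` input
[P1]-cont for a character `χ` of `Γ_K` to Ferrero–Washington over the abelian field `F' = K·ℚ(χ) ⊇ K` is the `ℤ_p`-extension
`F'·K_∞ / F'`, i.e. `ZpExtension.restrict κ F' h` with `h` the surjectivity of `κ ∘ res : Γ_{F'} → ℤ_p`; `[F' : K]` divides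
`p − 1`, so it is prime to `p`. This file proves that surjectivity for ANY finite extension `L/K` of degree prime to `p`
(`surjective_comp_absGaloisRestrict_of_coprime`), generalising the tree's degree-`2` case
`surjective_comp_absGaloisRestrict_of_finrank_eq_two` with the same proof: `res(Γ_L)` has index `[L : K]` in `Γ_K`
(`nat_card_quotient_range_absGaloisRestrict`), its image under the surjection `κ` has index dividing `[L : K]`
(`Subgroup.index_map_dvd`), and a subgroup of `ℤ_p` of index `n` prime to `p` is everything since `n ∈ ℤ_p^×` and
`n`-th powers lie in a subgroup of index `n` (`eq_top_of_index_coprime`). Publish-only (W-71); sorry-free; no named fact,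
no definition, no instance. NO summit statement, crux or stub is proved here. [cite: Washington1997, §13.1]
[cite: NeukirchANT1999, Ch. IV §1] [folklore]
-/

noncomputable section

open scoped Classical

open Field Literature.NumberTheory.GaloisRepresentations

universe u v

namespace Literature.NumberTheory.EllipticCurves.ZpExtension

variable {K : Type u} [Field K] [NumberField K] {p : ℕ} [Fact p.Prime]

omit [NumberField K] in
/-- A natural number prime to `p` is a unit of `ℤ_p`. [folklore] -/
theorem isUnit_natCast_padicInt_of_coprime {n : ℕ} (hn : n.Coprime p) : IsUnit ((n : ℕ) : ℤ_[p]) := by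
  rw [PadicInt.isUnit_iff]
  have hle : ‖((n : ℕ) : ℤ_[p])‖ ≤ 1 := PadicInt.norm_le_one _
  have hlt : ¬ ‖((n : ℕ) : ℤ_[p])‖ < 1 := by
    intro h
    have h' : ‖((n : ℤ) : ℤ_[p])‖ < 1 := by exact_mod_cast h
    rw [PadicInt.norm_int_lt_one_iff_dvd] at h'
    have hpn : p ∣ n := by exact_mod_cast h'
    have hp1 : p = 1 := Nat.Coprime.eq_one_of_dvd (Nat.Coprime.symm hn) hpn
    exact (Fact.out : p.Prime).one_lt.ne' hp1
  exact le_antisymm hle (not_lt.mp hlt)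

omit [NumberField K] in
/-- **A subgroup of `ℤ_p` (written multiplicatively) of index prime to `p` is everything**: it contains all
`[ℤ_p : M]`-th powers (`Subgroup.pow_index_mem`), and every element of `ℤ_p` is such a power (additively: `n` times
another) since `n ∈ ℤ_p^×`. [folklore] -/
theorem eq_top_of_index_coprime (M : Subgroup (Multiplicative ℤ_[p])) (hM : M.index.Coprime p) : M = ⊤ := by
  rw [eq_top_iff]
  intro y _
  obtain ⟨u, hu⟩ := isUnit_natCast_padicInt_of_coprime (p := p) hM
  set b : ℤ_[p] := (↑u⁻¹ : ℤ_[p]) * Multiplicative.toAdd y with hb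
  have hy : y = (Multiplicative.ofAdd b) ^ M.index := by
    rw [← ofAdd_nsmul, hb, nsmul_eq_mul, ← mul_assoc, ← hu, Units.mul_inv, one_mul, ofAdd_toAdd]
  rw [hy]
  exact Subgroup.pow_index_mem M _

/-- **`κ ∘ res : Γ_L → ℤ_p` is surjective when `[L : K]` is prime to `p`** (`L ∩ K_∞ = K` because `Gal(K_∞/K) ≅ ℤ_p`
has no non-trivial quotient of order prime to `p`): `res(Γ_L)` has index `[L : K]` in `Γ_K`
(`nat_card_quotient_range_absGaloisRestrict`), its image under the surjection `κ` has index dividing `[L : K]`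
(`Subgroup.index_map_dvd`), hence prime to `p`, hence it is all of `ℤ_p` (`eq_top_of_index_coprime`). The case
`[L : K] = 2`, `p` odd is the tree's `surjective_comp_absGaloisRestrict_of_finrank_eq_two`.
[cite: Washington1997, §13.1] [cite: NeukirchANT1999, Ch. IV §1] -/
theorem surjective_comp_absGaloisRestrict_of_coprime (κ : ZpExtension K p)
    (L : Type v) [Field L] [NumberField L] [Algebra K L] (hL : (Module.finrank K L).Coprime p) :
    Function.Surjective (κ.toContinuousMonoidHom.comp (absGaloisRestrict K L)) := by
  haveI : FiniteDimensional K L := Module.Finite.of_restrictScalars_finite ℚ K L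
  set H : Subgroup (absoluteGaloisGroup K) := (absGaloisRestrict K L).range with hH
  set f : absoluteGaloisGroup K →* Multiplicative ℤ_[p] := κ.toContinuousMonoidHom.toMonoidHom with hf
  have hHidx : H.index = Module.finrank K L := nat_card_quotient_range_absGaloisRestrict K L
  have hfs : Function.Surjective f := κ.surjective
  have hMidx : (H.map f).index ∣ Module.finrank K L := hHidx ▸ Subgroup.index_map_dvd H hfs
  have hM : H.map f = ⊤ := eq_top_of_index_coprime _ (Nat.Coprime.coprime_dvd_left hMidx hL)
  intro y
  have hy : y ∈ H.map f := hM ▸ Subgroup.mem_top y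
  obtain ⟨σ, ⟨τ, rfl⟩, hστ⟩ := Subgroup.mem_map.mp hy
  exact ⟨τ, hστ⟩

/-- **The `ℤ_p`-extension `L·K_∞/L` for `[L : K]` prime to `p`** — `restrict` with the surjectivity discharged; its kernel
subgroup is `res⁻¹(Gal(K̄/K_∞))` (`kerSubgroup_restrict`). Intended use (memo §11.3): `L = F' = K·ℚ(χ)`, `[F' : K] ∣ p − 1`.
[cite: Washington1997, §13.1] -/
def restrictOfCoprime (κ : ZpExtension K p) (L : Type v) [Field L] [NumberField L] [Algebra K L]
    (hL : (Module.finrank K L).Coprime p) : ZpExtension L p :=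
  κ.restrict L (surjective_comp_absGaloisRestrict_of_coprime κ L hL)

/-- Unfolding `restrictOfCoprime`. [cite: Washington1997, §13.1] -/
theorem restrictOfCoprime_apply (κ : ZpExtension K p) (L : Type v) [Field L] [NumberField L] [Algebra K L]
    (hL : (Module.finrank K L).Coprime p) (σ : absoluteGaloisGroup L) :
    κ.restrictOfCoprime L hL σ = κ (absGaloisRestrict K L σ) :=
  rfl

/-- The kernel subgroup of `restrictOfCoprime` is the preimage of `κ`'s under `res`. [cite: Washington1997, §13.1] -/
theorem kerSubgroup_restrictOfCoprime (κ : ZpExtension K p) (L : Type v) [Field L] [NumberField L] [Algebra K L]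
    (hL : (Module.finrank K L).Coprime p) :
    (κ.restrictOfCoprime L hL).kerSubgroup = κ.kerSubgroup.comap (absGaloisRestrict K L).toMonoidHom :=
  kerSubgroup_restrict κ L _

end Literature.NumberTheory.EllipticCurves.ZpExtension

end
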